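import Literature.AnabelianGeometry.AbsoluteAnabelian.MonoidKummerGaloisCyclotomeHomOverId
import Literature.AnabelianGeometry.AbsoluteAnabelian.MonoidKummerGaloisCyclotomeRestrictionWitness
import HarnessLib

/-!
# [AbsTopIII] Prop 3.2 (ii.4) along morphisms with FIELD-THEORETIC Galois component:
# `φ_M = j ∘ (x ↦ xᴹ)`, and the coefficient square holds IFF `M = 1` IFF `φ` IS the restriction morphism

S. Mochizuki, *Topics in Absolute Anabelian Geometry III*, §3 (bib key `MochizukiAbsTopIII2015`, lit key
`paper:url-5493eb38cbb7`): Def. 3.1 (ii) p. 67 (morphisms of MLF-Galois `TM`-pairs; the basic example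
«restriction to a finite extension»), Prop. 3.2 (ii) p. 71 l. 58 – p. 72 l. 6, Rmk. 3.2.1 p. 73, Prop. 3.2 (iv)
p. 72; [AbsAnab] Prop. 1.2.1 (vii) p. 11 (bib key `MochizukiAbsAnab2004`).

THE POINT (abc-iut cell, layer L4, node AbsTopIII:Prop3.2(ii), clause (ii.4); sequel of abc-iut-L4-t2's
p495791 / p496882 / p497331).  Let `φ = (φ_Π, φ_M) : (Π₁ ↷ 𝒪_Ē^⊳) → (Π₂ ↷ 𝒪_F̄^⊳)` be a morphism of model
MLF-Galois `TM`-pairs whose GALOIS COMPONENT IS FIELD-THEORETIC: it is the restriction along an identification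
`j : Ē ≃ F̄` over a finite `E/F` (`haug : ε₂(φ_Π g)(j x) = j(ε₁(g) x)`, the shape of abc-iut-L4-t2's
`MonoidKummerGaloisCyclotomeRestriction`, p446357), with `j⁻¹` preserving integrality (`hj` — a THEOREM at
abc-iut-L4-t11's witness, `absClosureEmbedding_mem_absIntegers_iff`).  Print's Def. 3.1 (ii) leaves `φ_M` free;
the kernel classifies it:

* `exists_homM_eq_restrict_pow`: **`φ_M = j ∘ (x ↦ xᴹ)` for one `M ∈ ℕ`** — `j⁻¹ ∘ φ_M` is a `G_E`-equivariant
  monoid endomorphism of `𝒪_Ē^⊳` over `id_{G_E}`, hence a power map (abc-iut-L4-t2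
  `MLFClosure.nonzeroIntegers_monoidHom_eq_pow`, p496882);
* `unitsLift_eq_of_homM_eq_restrict_pow`: then `φ_M^gp = j ∘ (u ↦ uᴹ)` on `Ēˣ`;
* **`coeffSquare_iff_homM_eq_restrict`**: Prop. 3.2 (ii)'s coefficient square `hsq(φ)` for THE reciprocity data
  (`TorsionReciprocityData.fundamental`) HOLDS IFF `φ_M = j` on `𝒪_Ē^⊳` — i.e. iff `φ` IS print's restriction
  morphism (`M = 1`; ⇐ is p446357's `coeffSquare_restrict`, ⇒ is p495791's necessary condition
  `bijective_cyclotome_map_unitsLift_of_coeffSquare` + p497331's `bijective_cyclotome_map_pow_iff`);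
  `coeffSquare_iff_bijective_cyclotome_map_of_geometric`: equivalently iff `Λ(φ_M^gp)` is bijective on `Ẑ(1)` —
  SUFFICIENCY of p495791's necessary condition for every morphism with geometric Galois component;
* `not_coeffSquare_of_geometric_of_ne` : along the power-twists `(φ_Π, j ∘ xᴹ)`, `M ≠ 1`, the square fails for
  EVERY pair of reciprocity data;
* §3, the witness: at abc-iut-L4-t11's mono-analytic models `(G_E ↷ 𝒪_Ē^⊳) → (G_F ↷ 𝒪_F̄^⊳)` of a finite `E/F`
  (`hj` discharged by `absClosureEquiv_mem_nonzeroIntegers`): every morphism over `res : G_E ↪ G_F` along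
  `j = ι⁻¹` has `φ_M = j ∘ xᴹ`, and `hsq(φ)` holds iff `φ_M = restrictHomM F E` (`coeffSquare_iff_homM_eq_restrictHomM`).

Together with p497331 (`β = id`) this settles the (ii.4) characterisation «`hsq(φ)` ⟺ `Λ(φ_M^gp)` bijective ⟺ `φ`
is an honest (un-twisted) leg» for every morphism of model `TM`-pairs whose Galois component is geometric; the
case of an exotic (non-geometric) open injection `β` is not addressed (it would need [QpGC]-type input).

No definition, no `Prop`-valued definition, no instance (the descended endomorphism is a proof-local `let`).
Universe `0`.  HONEST FRAMING: classical Kummer theory over the cell's model pairs; nothing here bears on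
[IUTchIII] Cor. 3.12; no side is taken; nothing asserts that abc is proved or refuted.
-/

noncomputable section

open scoped nonZeroDivisors

namespace Literature.AnabelianGeometry.AbsoluteAnabelian

open Function Field _root_.ValuativeRel
open Literature.NumberTheory.GaloisRepresentations

namespace GaloisMonoidPair.Hom

/-! ### §1 Morphisms with field-theoretic Galois component: `φ_M = j ∘ (x ↦ xᴹ)` -/

section Geometric

variable {C₁ C₂ : MLFClosure.{0}} [Algebra C₂.k C₁.K] (j : C₁.K ≃ₐ[C₂.k] C₂.K)
  {D₁ : ModelMLFGaloisData C₁.k C₁.K} {D₂ : ModelMLFGaloisData C₂.k C₂.K}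
  (φ : GaloisMonoidPair.Hom D₁.tmPair D₂.tmPair)
  (haug : ∀ (g : D₁.Pi) (x : C₁.K), D₂.aug (φ.homPi g) (j x) = j (D₁.aug g x))
  (hj : ∀ y : C₂.K, y ∈ nonzeroIntegers C₂.k C₂.K → j.symm y ∈ nonzeroIntegers C₁.k C₁.K)

include haug hj in
/-- **Along a morphism whose Galois component is the restriction along `j : Ē ≃ F̄`, the monoid component is
`φ_M = j ∘ (x ↦ xᴹ)` for one `M ∈ ℕ`**: `j⁻¹ ∘ φ_M` is a `G_E`-equivariant monoid endomorphism of `𝒪_Ē^⊳` over the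
identity, hence a power map (`MLFClosure.nonzeroIntegers_monoidHom_eq_pow`).
[cite: MochizukiAbsTopIII2015, Proposition 3.2 (iv) p.72] -/
theorem exists_homM_eq_restrict_pow :
    ∃ M : ℕ, ∀ m : ↥(nonzeroIntegers C₁.k C₁.K),
      ((φ.homM m : ↥(nonzeroIntegers C₂.k C₂.K)) : C₂.K) = j ((m : C₁.K) ^ M) := by
  -- the descended endomorphism `ψ := j⁻¹ ∘ φ_M` of `𝒪_Ē^⊳`
  let ψ : ↥(nonzeroIntegers C₁.k C₁.K) →* ↥(nonzeroIntegers C₁.k C₁.K) :=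
    { toFun := fun x => ⟨j.symm ((φ.homM x : ↥(nonzeroIntegers C₂.k C₂.K)) : C₂.K), hj _ (φ.homM x).2⟩
      map_one' := Subtype.ext (by
        change j.symm ((φ.homM 1 : ↥(nonzeroIntegers C₂.k C₂.K)) : C₂.K) = 1
        rw [map_one, OneMemClass.coe_one, map_one])
      map_mul' := fun x y => Subtype.ext (by
        change j.symm ((φ.homM (x * y) : ↥(nonzeroIntegers C₂.k C₂.K)) : C₂.K) =
          j.symm ((φ.homM x : ↥(nonzeroIntegers C₂.k C₂.K)) : C₂.K) *
            j.symm ((φ.homM y : ↥(nonzeroIntegers C₂.k C₂.K)) : C₂.K)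
        rw [map_mul, Submonoid.coe_mul, map_mul]) }
  have hψapp : ∀ x, (ψ x : C₁.K) = j.symm ((φ.homM x : ↥(nonzeroIntegers C₂.k C₂.K)) : C₂.K) := fun _ => rfl
  -- `ψ` is `G_E`-equivariant over the identity
  have hψ : ∀ (σ : C₁.K ≃ₐ[C₁.k] C₁.K) (x : ↥(nonzeroIntegers C₁.k C₁.K)),
      (ψ ⟨σ • (x : C₁.K), smul_mem_nonzeroIntegers σ x.2⟩ : C₁.K) = σ • (ψ x : C₁.K) := by
    intro σ x
    obtain ⟨g, rfl⟩ := D₁.aug_surjective σ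
    have hgx : (⟨D₁.aug g • (x : C₁.K), smul_mem_nonzeroIntegers (D₁.aug g) x.2⟩ :
        ↥(nonzeroIntegers C₁.k C₁.K)) = g • x := Subtype.ext rfl
    rw [hψapp, hψapp, hgx, φ.smul_comm, ModelMLFGaloisData.nonzeroIntegers_coe_smul, AlgEquiv.smul_def,
      AlgEquiv.smul_def]
    conv_lhs => rw [← j.apply_symm_apply ((φ.homM x : ↥(nonzeroIntegers C₂.k C₂.K)) : C₂.K)]
    rw [haug, j.symm_apply_apply]
  obtain ⟨M, hM⟩ := MLFClosure.nonzeroIntegers_monoidHom_eq_pow ψ hψ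
  refine ⟨M, fun m => ?_⟩
  have h : (ψ m : C₁.K) = (m : C₁.K) ^ M := by rw [hM, SubmonoidClass.coe_pow]
  rw [hψapp] at h
  rw [← h, j.apply_symm_apply]

/-- If `φ_M = j ∘ (x ↦ xᴹ)` on `𝒪_Ē^⊳`, then `φ_M^gp = j ∘ (u ↦ uᴹ)` on `Ēˣ`.
[cite: MochizukiAbsTopIII2015, Definition 3.1 (iii) p.68] -/
theorem unitsLift_eq_of_homM_eq_restrict_pow {M : ℕ}
    (hM : ∀ m : ↥(nonzeroIntegers C₁.k C₁.K),
      ((φ.homM m : ↥(nonzeroIntegers C₂.k C₂.K)) : C₂.K) = j ((m : C₁.K) ^ M)) :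
    ModelMLFGaloisData.unitsLift φ.homM = (Units.map (j : C₁.K →* C₂.K)).comp (powMonoidHom M) :=
  (ModelMLFGaloisData.unitsLift_unique φ.homM _ fun m => Units.ext (by
    rw [MonoidHom.comp_apply, powMonoidHom_apply, Units.coe_map, MonoidHom.coe_coe, Units.val_pow_eq_pow_val,
      ModelMLFGaloisData.coe_toUnit, ModelMLFGaloisData.coe_toUnit, hM])).symm

/-- `Λ(j)` is bijective on cyclotomes (`j` an isomorphism). [cite: MochizukiAbsTopIII2015, Remark 3.2.1 p.73] -/
theorem bijective_cyclotome_map_unitsMap :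
    Bijective (EtaleTheta.cyclotome.map (Units.map (j : C₁.K →* C₂.K))) :=
  EtaleTheta.cyclotome.map_bijective_of_bijective _ (Units.mapEquiv (j : C₁.K ≃* C₂.K)).bijective

include haug hj in
/-- **Along a morphism with field-theoretic Galois component, `Λ(φ_M^gp)` is bijective on `Ẑ(1)` IFF `φ_M = j`
on `𝒪_Ē^⊳`** (`φ_M = j ∘ xᴹ` and `Λ(u ↦ uᴹ)` is bijective only for `M = 1`).
[cite: MochizukiAbsTopIII2015, Remark 3.2.1 p.73] -/
theorem bijective_cyclotome_map_unitsLift_iff_homM_eq_restrict :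
    Bijective (EtaleTheta.cyclotome.map (ModelMLFGaloisData.unitsLift φ.homM)) ↔
      ∀ m : ↥(nonzeroIntegers C₁.k C₁.K), ((φ.homM m : ↥(nonzeroIntegers C₂.k C₂.K)) : C₂.K) = j (m : C₁.K) := by
  obtain ⟨M, hM⟩ := exists_homM_eq_restrict_pow j φ haug hj
  have hL := unitsLift_eq_of_homM_eq_restrict_pow j φ hM
  have hcomp : (EtaleTheta.cyclotome.map (ModelMLFGaloisData.unitsLift φ.homM) :
      EtaleTheta.cyclotome (C₁.K)ˣ → EtaleTheta.cyclotome (C₂.K)ˣ) =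
      EtaleTheta.cyclotome.map (Units.map (j : C₁.K →* C₂.K)) ∘
        EtaleTheta.cyclotome.map (powMonoidHom M : (C₁.K)ˣ →* (C₁.K)ˣ) := by
    rw [hL]
    exact funext fun ζ => cyclotome_map_comp_apply _ _ ζ
  rw [hcomp, (bijective_cyclotome_map_unitsMap j).of_comp_iff', MLFClosure.bijective_cyclotome_map_pow_iff C₁ M]
  constructor
  · rintro rfl m
    rw [hM, pow_one]
  · intro h1
    haveI : CharZero C₁.K := charZero_of_injective_algebraMap (algebraMap C₁.k C₁.K).injective
    -- `j (2ᴹ) = φ_M(2) = j 2` forces `M = 1`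
    have htwo : (2 : C₁.K) ∈ nonzeroIntegers C₁.k C₁.K := ⟨by simp, two_ne_zero⟩
    have h2 : j ((2 : C₁.K) ^ M) = j (2 : C₁.K) := by rw [← hM ⟨2, htwo⟩, h1 ⟨2, htwo⟩]
    have h2' : ((2 : ℕ) : C₁.K) ^ M = ((2 : ℕ) : C₁.K) ^ 1 := by simpa using j.injective h2
    rw [← Nat.cast_pow, ← Nat.cast_pow, Nat.cast_inj] at h2'
    exact Nat.pow_right_injective le_rfl h2'

variable [Algebra C₂.k C₁.k] [FiniteDimensional C₂.k C₁.k] [IsScalarTower C₂.k C₁.k C₁.K]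
  [ValuativeExtension C₂.k C₁.k]

include haug hj in
/-- **[AbsTopIII] Prop 3.2 (ii.4) along a morphism with FIELD-THEORETIC Galois component: the coefficient square
for THE reciprocity data HOLDS IFF `φ_M = j` on `𝒪_Ē^⊳`, i.e. iff `φ` IS print's restriction morphism** (and not
one of its power-twists `(φ_Π, j ∘ xᴹ)`, `M ≠ 1`).  ⇐: abc-iut-L4-t2's `coeffSquare_restrict` (p446357,
[AbsAnab] Prop. 1.2.1 (vii) through abc-iut-L4-t11); ⇒: `Λ(φ_M^gp)` must be bijective (p495791), and
`Λ(j ∘ xᴹ)` is so only for `M = 1`. [cite: MochizukiAbsTopIII2015, Proposition 3.2 (ii) p.72] -/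
theorem coeffSquare_iff_homM_eq_restrict (h₁ : IsOpenMap D₁.aug) (h₂ : IsOpenMap D₂.aug) :
    (∀ ζ : muZhat (absoluteGaloisGroup C₁.k),
      EtaleTheta.cyclotome.map (ModelMLFGaloisData.rootsHom C₂ (TorsionReciprocityData.fundamental C₂.k))
          (φ.muZhatMap h₁ h₂ ζ) =
        EtaleTheta.cyclotome.map (ModelMLFGaloisData.unitsLift φ.homM)
          (EtaleTheta.cyclotome.map
            (ModelMLFGaloisData.rootsHom C₁ (TorsionReciprocityData.fundamental C₁.k)) ζ)) ↔
      ∀ m : ↥(nonzeroIntegers C₁.k C₁.K), ((φ.homM m : ↥(nonzeroIntegers C₂.k C₂.K)) : C₂.K) = j (m : C₁.K) := by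
  refine ⟨fun hsq => ?_, fun hφM => φ.coeffSquare_restrict j haug hφM h₁ h₂⟩
  exact (bijective_cyclotome_map_unitsLift_iff_homM_eq_restrict j φ haug hj).mp
    (bijective_cyclotome_map_unitsLift_of_coeffSquare φ h₁ h₂ _ _ hsq)

include haug hj in
/-- **Equivalently: the coefficient square for THE data holds IFF `Λ(φ_M^gp)` is bijective on `Ẑ(1)`** —
SUFFICIENCY of p495791's necessary condition for every morphism with field-theoretic Galois component.
[cite: MochizukiAbsTopIII2015, Proposition 3.2 (ii) p.72] -/
theorem coeffSquare_iff_bijective_cyclotome_map_of_geometric (h₁ : IsOpenMap D₁.aug) (h₂ : IsOpenMap D₂.aug) :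
    (∀ ζ : muZhat (absoluteGaloisGroup C₁.k),
      EtaleTheta.cyclotome.map (ModelMLFGaloisData.rootsHom C₂ (TorsionReciprocityData.fundamental C₂.k))
          (φ.muZhatMap h₁ h₂ ζ) =
        EtaleTheta.cyclotome.map (ModelMLFGaloisData.unitsLift φ.homM)
          (EtaleTheta.cyclotome.map
            (ModelMLFGaloisData.rootsHom C₁ (TorsionReciprocityData.fundamental C₁.k)) ζ)) ↔
      Bijective (EtaleTheta.cyclotome.map (ModelMLFGaloisData.unitsLift φ.homM)) := by
  rw [coeffSquare_iff_homM_eq_restrict j φ haug hj h₁ h₂,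
    bijective_cyclotome_map_unitsLift_iff_homM_eq_restrict j φ haug hj]

omit [Algebra C₂.k C₁.k] [FiniteDimensional C₂.k C₁.k] [IsScalarTower C₂.k C₁.k C₁.K]
  [ValuativeExtension C₂.k C₁.k] in
include haug hj in
/-- **Along a power-twisted restriction `(φ_Π, j ∘ xᴹ)` with `φ_M ≠ j` on `𝒪_Ē^⊳`, the coefficient square fails
for EVERY pair of reciprocity data.** [cite: MochizukiAbsTopIII2015, Proposition 3.2 (ii) p.72] -/
theorem not_coeffSquare_of_geometric_of_ne (h₁ : IsOpenMap D₁.aug) (h₂ : IsOpenMap D₂.aug)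
    (R₁ : TorsionReciprocityData C₁.k) (R₂ : TorsionReciprocityData C₂.k)
    (hne : ¬ ∀ m : ↥(nonzeroIntegers C₁.k C₁.K), ((φ.homM m : ↥(nonzeroIntegers C₂.k C₂.K)) : C₂.K) = j (m : C₁.K)) :
    ¬ ∀ ζ : muZhat (absoluteGaloisGroup C₁.k),
      EtaleTheta.cyclotome.map (ModelMLFGaloisData.rootsHom C₂ R₂) (φ.muZhatMap h₁ h₂ ζ) =
        EtaleTheta.cyclotome.map (ModelMLFGaloisData.unitsLift φ.homM)
          (EtaleTheta.cyclotome.map (ModelMLFGaloisData.rootsHom C₁ R₁) ζ) :=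
  fun hsq => hne ((bijective_cyclotome_map_unitsLift_iff_homM_eq_restrict j φ haug hj).mp
    (bijective_cyclotome_map_unitsLift_of_coeffSquare φ h₁ h₂ R₁ R₂ hsq))

end Geometric

end GaloisMonoidPair.Hom

/-! ### §3 The witness: morphisms `(G_E ↷ 𝒪_Ē^⊳) → (G_F ↷ 𝒪_F̄^⊳)` over `res : G_E ↪ G_F` -/

section Witness

variable (F E : Type) [Field F] [ValuativeRel F] [TopologicalSpace F] [IsNonarchimedeanLocalField F] [CharZero F]
  [Field E] [ValuativeRel E] [TopologicalSpace E] [IsNonarchimedeanLocalField E] [CharZero E]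
  [Algebra F E] [FiniteDimensional F E] [ValuativeExtension F E]

omit [CharZero E] in
/-- `j⁻¹ = ι|` preserves integrality: `ι y ∈ 𝒪_Ē^⊳` for `y ∈ 𝒪_F̄^⊳` (spectral norms agree,
abc-iut-L4-t11's `absClosureEmbedding_mem_absIntegers_iff`) — the hypothesis `hj` of §1 at the witness.
[cite: MochizukiAbsTopIII2015, Definition 3.1 (i) p.66] -/
theorem absClosureEquiv_mem_nonzeroIntegers (y : AlgebraicClosure F)
    (hy : y ∈ nonzeroIntegers F (AlgebraicClosure F)) :
    (absClosureEquiv F E).symm.symm y ∈ nonzeroIntegers E (AlgebraicClosure E) := by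
  rw [AlgEquiv.symm_symm]
  refine ⟨?_, (map_ne_zero _).mpr hy.2⟩
  have h : absClosureEmbedding F E y ∈ absIntegers 𝒪[E] E :=
    (absClosureEmbedding_mem_absIntegers_iff (F := F) (E := E) y).mpr hy.1
  have he : absClosureEmbedding F E y = absClosureEquiv F E y := by
    conv_lhs => rw [← (absClosureEquiv F E).symm_apply_apply y]
    exact absClosureEmbedding_absClosureEquiv_symm F E _
  rw [he] at h
  exact h

variable (φ : GaloisMonoidPair.Hom (ModelMLFGaloisData.galois E (AlgebraicClosure E)).tmPair
    (ModelMLFGaloisData.galois F (AlgebraicClosure F)).tmPair)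
  (haug : ∀ (g : (ModelMLFGaloisData.galois E (AlgebraicClosure E)).Pi) (x : AlgebraicClosure E),
    (ModelMLFGaloisData.galois F (AlgebraicClosure F)).aug (φ.homPi g) ((absClosureEquiv F E).symm x) =
      (absClosureEquiv F E).symm ((ModelMLFGaloisData.galois E (AlgebraicClosure E)).aug g x))

include haug in
/-- **At the witness: every morphism `(G_E ↷ 𝒪_Ē^⊳) → (G_F ↷ 𝒪_F̄^⊳)` over the restriction along `j = ι⁻¹` has
`φ_M = j ∘ (x ↦ xᴹ)`** for one `M ∈ ℕ` — abc-iut-L4-t11's `restrictHom F E` (`M = 1`) and its power-twists are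
ALL of them. [cite: MochizukiAbsTopIII2015, Proposition 3.2 (iv) p.72] -/
theorem exists_homM_eq_restrictHomM_pow :
    ∃ M : ℕ, ∀ m : ↥(nonzeroIntegers E (AlgebraicClosure E)),
      ((φ.homM m : ↥(nonzeroIntegers F (AlgebraicClosure F))) : AlgebraicClosure F) =
        ((restrictHomM F E (m ^ M) : ↥(nonzeroIntegers F (AlgebraicClosure F))) : AlgebraicClosure F) := by
  obtain ⟨M, hM⟩ := GaloisMonoidPair.Hom.exists_homM_eq_restrict_pow
    (C₁ := MLFClosure.ofAlgClosure E) (C₂ := MLFClosure.ofAlgClosure F) ((absClosureEquiv F E).symm) φ haug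
    (absClosureEquiv_mem_nonzeroIntegers F E)
  exact ⟨M, fun m => by rw [hM, coe_restrictHomM_apply, SubmonoidClass.coe_pow]⟩

include haug in
/-- **At the witness: the coefficient square for THE data holds IFF `φ_M = restrictHomM F E`** (so among all
morphisms over `res : G_E ↪ G_F` along `ι⁻¹`, Prop. 3.2 (ii)'s `μ_Ẑ(G)`-naturality singles out exactly
abc-iut-L4-t11's `restrictHom F E`). [cite: MochizukiAbsTopIII2015, Proposition 3.2 (ii) p.72] -/
theorem coeffSquare_iff_homM_eq_restrictHomM :
    (∀ ζ : muZhat (absoluteGaloisGroup E),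
      EtaleTheta.cyclotome.map
          (ModelMLFGaloisData.rootsHom (MLFClosure.ofAlgClosure F) (TorsionReciprocityData.fundamental F))
          (φ.muZhatMap (C₁ := MLFClosure.ofAlgClosure E) (C₂ := MLFClosure.ofAlgClosure F)
            (ModelMLFGaloisData.galois_aug_isOpenMap E (AlgebraicClosure E))
            (ModelMLFGaloisData.galois_aug_isOpenMap F (AlgebraicClosure F)) ζ) =
        EtaleTheta.cyclotome.map (ModelMLFGaloisData.unitsLift φ.homM)
          (EtaleTheta.cyclotome.map
            (ModelMLFGaloisData.rootsHom (MLFClosure.ofAlgClosure E) (TorsionReciprocityData.fundamental E)) ζ)) ↔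
      φ.homM = restrictHomM F E := by
  rw [GaloisMonoidPair.Hom.coeffSquare_iff_homM_eq_restrict (C₁ := MLFClosure.ofAlgClosure E)
    (C₂ := MLFClosure.ofAlgClosure F) ((absClosureEquiv F E).symm) φ haug (absClosureEquiv_mem_nonzeroIntegers F E)]
  constructor
  · intro h
    exact MonoidHom.ext fun m => Subtype.ext (by rw [h m, coe_restrictHomM_apply])
  · intro h m
    rw [h, coe_restrictHomM_apply]

end Witness

end Literature.AnabelianGeometry.AbsoluteAnabelian

end
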